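import Summits.QuantumFields.YangMills.Theorems.BalabanLadderIRPinnedExitCofinal
import Summits.QuantumFields.YangMills.Theorems.BalabanLadderIRRankPurityCofinalDefs
import Summits.QuantumFields.YangMills.Theorems.BalabanLadderIRTwistCostOfPurity
import Summits.QuantumFields.YangMills.Theses.BalabanLadder
import Literature.MathematicalPhysics.QuantumFieldTheory.TomboulisConfinementClaim
import Literature.Barriers.QuantumFields.MigdalKadanoffGroupBlindness
import HarnessLib

/-!
# Crux `IRcof` (stmt-QuantumFields-26930) ∕ supplier token PX of `IR` (stmt-QuantumFields-19354) — LINE «mk-lag-sandwich»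
# (ideator ym-ir-idea-19 gen 0, lens `nearmiss`: Tomboulis 2007 re-typed in the PINNED cold-box currency, deficit MEASURED)

HONEST LABEL.  Nothing here proves the Yang–Mills mass gap (Clay), `IRcof`, `IR`, `PinnedExitAt (1/24)`, confinement, or the
existence of a single pure box; `R4` closes only the conditional finite-𝕋⁴ rung `BalabanLadder.UV`; R2c stays IDEA-BOUND; nothing
continuum ∕ OS ∕ Clay is touched.  The four `stub_*` below carry ALL the content; everything else is bookkeeping PROVED here.

THE NEAR-MISS (census B13, CLAIM): Tomboulis (arXiv:0707.2179) sandwiches the SU(2) vortex (= 't Hooft temporal-twist) free energy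
between Migdal–Kadanoff (MK) potential-moving decimations; the upper ∕ lower MK BOUNDS on partition functions are theorems
(Tomboulis–Yaffe 1985, his Props. II.1–III.1), the contested step is the COMMON-INTERPOLATION ∕ monotonicity argument §5 (5.29)–(5.47)
(Ito–Seiler arXiv:0711.4930 (3.2)–(3.5); arXiv:0803.3019 Problems 1–3 with the `U(1)₄` no-go).  MK's native observable — the twist
free energy `1 − Z⁽ᶻ⁾/Z` — is EXACTLY the F-half of the pinned purity number PXcof (row 21 `flux-purity-split`: purity = confined
temporal flux ∧ vacuum-sector purity, seam PROVED).  This line types the MK chain ITSELF (general compact `G`, Haar convolution,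
`b = 2`, `d = 4`, `r = 1`) and splits Tomboulis's claim at the joint the pinned currency exposes:

* `MKTwistMinorant`  (crux K_min — Tomboulis's (5.29) at `r = 1` in cold-box geometry, beyond the floor scale): the true twist cost of
  the Wilson model on `(8·2ⁿ)³ × (t·2ⁿ)` is AT MOST the twist cost of the `n`-fold MK-decimated plaquette weight on the coarse box `8³ × t`,
  `t ∈ {2,4}`, for fine boxes of at least `S_K` floor-lengths (femto boxes excluded: there the order is a one-loop coin flip).
* `MKBoundedLag`     (crux K_lag — THE MEASURED DEFICIT): `k₀` octaves past the floor scale `1/a(β)` the MK weight is within `10⁻³`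
  of trivial (sup norm), uniformly in `β ≥ β_M`.  Ito 1985 ∕ Müller–Schiemann 1988 give MK → strong coupling for EACH `β` (after
  `n(β) ~ β` steps); the pinned currency asks for the LAG behind the true correlation length to be BOUNDED.  Ideator's numerics
  (SU(2), Bessel-exact MK, this session): first `10⁻³`-SC level `n = 9, 10, 11` at `β_W = 2.3, 2.5, 2.7`, i.e. `8·2ⁿ ≈ 1.5–1.7·10³ ξ_σ`
  (finite `k₀ ≈ 11` on the E2-Q3 window); MK's asymptotic decrement `0.2507 β_W`/octave vs one-loop `8b₀ln2 = 0.2575` ⇒ the lag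
  DRIFTS `+0.10` octave per unit `β_W` — as typed (fixed `k₀`, all large `β`) K_lag is guidance-false as `β → ∞` under asymptotic
  freedom; `b = 2` is MK's fastest scale factor and `r < 1` stalls (Ito–Seiler 2009 §4a).  The single input to improve: a
  reflection-positive BOUNDING decimation exact through two loops (successor line).  Filed to put the NUMBER on the leak.
* `SCTwistBound`     (support S_sc — Münster 1981 ∕ Ito–Seiler 2008 Thm 2.2 (1), generalised to sup-small weights on the two
  anisotropic coarse boxes): a continuous plaquette weight within `10⁻³` of `1` has twist cost `≤ 1/96` on `8³ × 2` and `8³ × 4`.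
* `VacuumPurityCorridor` (residual V — the `e = 0`-sector gap half of purity, row 21's `VacuumSectorPuritySC` re-quantified to the
  pinned corridor `S ≤ a(β)·L ≤ T`): no twist observable sees the `0⁺⁺` gap; MK cannot supply it (honest residual, E-adjacent).

COMPOSITION (PROVED, §4): K_lag ∧ K_min ∧ S_sc ∧ V ⇒ `PinnedExit96.PinnedExitAt (1/24)` (19354's token PX, BY NAME) ⇒
`PXcof24` = VERBATIM the 26930 slot token `PinnedCofinalBill.PinnedExitsCofinalAt (1/24)` (via the landed
`PinnedExitCofinal.pinnedExitsCofinal_of_pinnedExitAt`) ⇒ with the slot's residual `IRnscCof`, `Theses.BalabanLadder.IRcof` BY NAME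
(`IRcof_of`).  Pin: `T = 16·max(2^{k₀}, S/8, S_K/8)`; box `L = 8·2ⁿ` with `n` least such that `max(2^{k₀}, S/8, S_K/8) ≤ a(β)·2ⁿ`.

DISPROOF ∕ NEGATIVES HONOURED: coupling-first quantifiers throughout (`not_uniformExit24_holds`, p624174: box-before-coupling is
refuted); the floor `LowerBounds G r a` is CONSUMED by K_lag and V (floor-free pinned exit is false); simply-connected simple `G`
only (K_min's `U(1)₄` analogue is FALSE at weak coupling — `Literature.Barriers.QuantumFields.MigdalKadanoff`, Ito–Seiler 2009 §5;
evasion (a) of `MigdalKadanoffGroupBlindness`: the group enters through the VELOCITY of the MK flow relative to `a(β)`, i.e. K_lag).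
DEDUP: `defect_le_of_flux_vac` ∕ `coldDefect_le_of_flux_vac_tw` are row 21's seam (idea-10, `Cruxes/IR/Lines/flux_purity_split.lean`
§2) re-spelled over `wilsonFinTorusTwistedPartition` — NOT new; SU(2)-specialised MK vocabulary exists in
`Literature/…/TomboulisConfinementClaim.lean` (`Tomboulis2007.mkStepFun`, `MKTIneq`, `MKFlowToStrongCoupling`) — the general-`G`
Haar-convolution MK step, K_min, K_lag, S_sc are new decls.
-/

set_option autoImplicit false

noncomputable section

open Filter Topology MeasureTheory
open Literature.MathematicalPhysics.QuantumFieldTheory Literature.MathematicalPhysics.QuantumLattice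
open Summit.QuantumFields.YangMills.Cruxes.OSLegsFromFemtoAndGap.DlrCollarTransfer (LowerBounds)
open Summit.QuantumFields.YangMills.Cruxes.IR.ColdPurityBridge (coldDefect)
open Summit.QuantumFields.YangMills.Cruxes.IR.RankPurity (IRnscCof)
open Summit.QuantumFields.YangMills.Cruxes.IR.PinnedExit96 (PinnedExitAt)
open Summit.QuantumFields.YangMills.Cruxes.IR.PinnedExitCofinal (cofinalGapOn_of_pinnedExits pinnedExitsCofinal_of_pinnedExitAt)
open Summit.QuantumFields.YangMills.Cruxes.IR.TwistCost (twistedPartition_le)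

namespace Summit.QuantumFields.YangMills.Cruxes.IRcof.MKLagSandwich

/-! ## §0 The Migdal–Kadanoff potential-moving recursion for a general compact group (definitions) -/

section Defs

variable {G : Type} [Group G] [TopologicalSpace G] [MeasurableSpace G]

/-- Wilson's one-plaquette Boltzmann weight in the tree's normalisation: `exp (−β (N − Re tr ρ U))`, so that the product over the
plaquettes of a box is the integrand of `wilsonFinTorusPartition`. -/
def wilsonPlaqWeight {N : ℕ} (ρ : G →* Matrix (Fin N) (Fin N) ℂ) (β : ℝ) : G → ℝ :=
  fun U => Real.exp (-β * ((N : ℝ) - (ρ U).trace.re))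

variable [IsTopologicalGroup G] [CompactSpace G] [BorelSpace G]

/-- Haar convolution of two real functions on `G`: `(g ⋆ h)(U) = ∫ g(V) h(V⁻¹U) dV`. -/
def haarConv (g h : G → ℝ) : G → ℝ := fun U => ∫ V, g V * h (V⁻¹ * U) ∂haarProbability G

/-- `(k+1)`-fold Haar convolution power `g^{⋆(k+1)}`. -/
def haarConvPow (g : G → ℝ) : ℕ → G → ℝ
  | 0 => g
  | k + 1 => haarConv g (haarConvPow g k)

/-- ONE Migdal–Kadanoff potential-moving step, scale factor `b = 2`, `d = 4`, decimation parameter `r = 1`, normalised at the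
identity: strengthen the plaquette weight `w ↦ w^{b^{d−2}} = w⁴` (move the `b²−…` interior plaquettes onto the block faces), then
decimate `b² = 4` plaquettes in series (four-fold convolution). [Migdal 1975; Kadanoff 1976; Tomboulis 2007 (2.8)–(2.12), `ζ = b²`] -/
def mkStep (w : G → ℝ) : G → ℝ :=
  fun U => haarConvPow (fun V => w V ^ 4) 3 U / haarConvPow (fun V => w V ^ 4) 3 1

/-- `n` MK steps applied to the weight normalised by its value at `1`. -/
def mkIter : ℕ → (G → ℝ) → G → ℝ
  | 0, w => fun U => w U / w 1
  | n + 1, w => mkStep (mkIter n w)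

/-- The temporally twisted partition function of the box `n₀ × n₁ × n₂ × n₃` for a GENERAL plaquette weight `w` (twist
`z = (z 0, z 1, z 2)` on 't Hooft's coclosed stacks, `tHooftTwistFactor`): VERBATIM `wilsonFinTorusTwistedPartition` with
`exp (−β (N − Re tr ρ ·))` replaced by `w`. -/
def weightedTwistedZ (w : G → ℝ) (z : Fin 4 → G) (n₀ n₁ n₂ n₃ : ℕ) : ℝ :=
  ∫ U, ∏ x : FinTorusSite n₀ n₁ n₂ n₃, ∏ q : {q : Fin 4 × Fin 4 // q.1 < q.2},
      w (tHooftTwistFactor z x q.1.1 q.1.2 * finTorusPlaquette U x q.1.1 q.1.2)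
    ∂(Measure.pi fun _ : FinTorusSite n₀ n₁ n₂ n₃ × Fin 4 => haarProbability G)

/-- Twist cost `1 − Z_w⁽ᶻ⁾/Z_w` of the cold box `L³ × t` for the general weight `w`. -/
def twistCostW (w : G → ℝ) (z : Fin 4 → G) (L t : ℕ) : ℝ :=
  1 - weightedTwistedZ w z L L L t / weightedTwistedZ w 1 L L L t

/-- Twist cost `1 − Z⁽ᶻ⁾/Z` of the cold box `L³ × t` for the Wilson action at coupling `β` (the tree's partition functions). -/
def twistCost {N : ℕ} (ρ : G →* Matrix (Fin N) (Fin N) ℂ) (β : ℝ) (z : Fin 4 → G) (L t : ℕ) : ℝ :=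
  1 - wilsonFinTorusTwistedPartition ρ β z L L L t / wilsonFinTorusPartition ρ β L L L t

end Defs

/-! ## §1 The slot token PXcof(1∕24), spelled out, and the four obligations (OPEN — nothing claimed) -/

/-- **PXcof(1∕24)** — VERBATIM the body of the 26930 slot's `PinnedCofinalBill.PinnedExitsCofinalAt (1/24)`
(`Cruxes/IRcof/Lines/pinned_cofinal_bill.lean` §1; that workfile is not an importable build target, so the token is spelled out here —
the two agree by `Iff.rfl`) = the conclusion of the landed `PinnedExitCofinal.pinnedExitsCofinal_of_pinnedExitAt` at `θ = 1/24`. -/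
def PXcof24 : Prop :=
  ∀ (G : Type) [Group G] [TopologicalSpace G] [IsTopologicalGroup G] [CompactSpace G],
    IsCompactSimpleLieGroup G → SimplyConnectedSpace G →
    letI : MeasurableSpace G := borel G
    haveI : BorelSpace G := ⟨rfl⟩
    ∀ (r : LatticeRep G) (a : ℝ → ℝ), (∀ β, 0 < a β) → Tendsto a atTop (𝓝 0) → LowerBounds G r a →
      ∃ T : ℝ, ∀ β₁ : ℝ, ∃ β : ℝ, β₁ ≤ β ∧ ∃ L : ℕ, 8 ≤ L ∧ a β * (L : ℝ) ≤ T ∧ coldDefect r.ρ β L ≤ (1 / 24 : ℝ)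


/-- **S_sc (support) — strong-coupling twist bound for a general near-trivial weight on the coarse cold boxes.**  A continuous
plaquette weight within `10⁻³` of `1` in sup norm has temporal-twist cost `≤ 1/96` on `8³ × 2` and `8³ × 4` for every central twist.
Polymer expansion: only clusters containing a surface wrapping a temporal `(μ,3)` 2-torus (`≥ 16` plaquettes) feel a central twist
['t Hooft 1979 §2; Münster 1981; Ito–Seiler arXiv:0803.3019 Thm 2.2 (1)]; activity `2·10⁻³` is deep inside the Kotecký–Preiss
radius in `d = 4`.  Why it might fail: only by a misstated constant (the margin is `> 10³⁰`). -/
def SCTwistBound : Prop :=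
  ∀ (G : Type) [Group G] [TopologicalSpace G] [IsTopologicalGroup G] [CompactSpace G] [MeasurableSpace G] [BorelSpace G],
    ∀ w : G → ℝ, Continuous w → (∀ U : G, |w U - 1| ≤ 1 / 1000) →
      ∀ z : Fin 4 → G, (∀ μ, z μ ∈ Subgroup.center G) → ∀ t : ℕ, (t = 2 ∨ t = 4) →
        twistCostW w z 8 t ≤ 1 / 96

/-- **K_min (crux, rank 3) — the MK twist MINORANT in cold-box geometry (Tomboulis 2007 (5.29) at `r = 1`), BEYOND THE FLOOR SCALE.**
For simply-connected compact simple `G`, under the crux's hypotheses on the unit map `a` (which pin `a(β)` to the physical scale), there are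
`S_K, β_K` such that for `β ≥ β_K`, every level `n` whose fine box is at least `S_K` floor-lengths (`S_K ≤ a(β)·8·2ⁿ` — femto fine boxes are
EXCLUDED: there both costs are `1 − O(β⁻²)` and the order is a one-loop coin flip unrelated to confinement), every central temporal twist and
`t ∈ {2,4}`: the Wilson twist cost on `(8·2ⁿ)³ × (t·2ⁿ)` is at most the twist cost of the `n`-fold MK-decimated weight on `8³ × t`.  Deep-IR
asymptotics (`n → ∞`, `β` fixed) hold at guidance grade with margin `σa²/σ_MK ≈ 2·10³` (MK's transported string tension is far BELOW the
truth: over-ordering).  Why it might fail: it fails exactly where MK's coarse model is MORE disordered than the truth at scale `2ⁿ`, i.e. where MK outruns the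
true RG; the `U(1)₄` analogue is FALSE at weak coupling (light flux, Guth ∕ Fröhlich–Spencer vs MK → SC: Ito–Seiler 2009 §5);
for SU(2) MK(b=2) runs BEHIND the truth at every level on `β_W ∈ [2.3, 2.7]` (first step backward `+0.17…+0.22`, lag
`≈ 1.0–1.5` octaves) and asymptotically (`0.2507 < 0.2575` per octave) — guidance-consistent, formally Tomboulis's open claim
(Ito–Seiler's objection (3.2)–(3.5) is to the representation behind (5.29), not to a counterexample). [arXiv:0707.2179 §5;
arXiv:0711.4930 §3; TomboulisYaffe1985] -/
def MKTwistMinorant : Prop :=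
  ∀ (G : Type) [Group G] [TopologicalSpace G] [IsTopologicalGroup G] [CompactSpace G],
    IsCompactSimpleLieGroup G → SimplyConnectedSpace G →
    letI : MeasurableSpace G := borel G
    haveI : BorelSpace G := ⟨rfl⟩
    ∀ (r : LatticeRep G) (a : ℝ → ℝ), (∀ β, 0 < a β) → Tendsto a atTop (𝓝 0) → LowerBounds G r a →
      ∃ (SK βK : ℝ), ∀ β : ℝ, βK ≤ β → ∀ n : ℕ, SK ≤ a β * (8 * (2 : ℝ) ^ n) →
        ∀ z : Fin 4 → G, (∀ μ, z μ ∈ Subgroup.center G) → ∀ t : ℕ, (t = 2 ∨ t = 4) →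
          twistCost r.ρ β z (8 * 2 ^ n) (t * 2 ^ n) ≤ twistCostW (mkIter n (wilsonPlaqWeight r.ρ β)) z 8 t

/-- **K_lag (crux, rank 2 — THE MEASURED DEFICIT) — MK reaches strong coupling a BOUNDED number of octaves past the floor scale.**
Under the crux's own hypotheses (`a > 0`, `a → 0`, the floor `LowerBounds G r a`, which pins `a(β)` to the physical scale from both
sides) there are `k₀, β_M` such that for every `β ≥ β_M` and every level `n` with `2^{k₀} ≤ a(β)·2ⁿ` the MK weight `mkIter n w_β` is a
continuous weight within `10⁻³` of `1`.  MK → SC for each fixed `β` is Ito 1985 ∕ Müller–Schiemann 1988 (SU(2), `n(β) = O(β)`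
steps); the content is the UNIFORMITY of the lag `k₀`.  Why it might fail (it does, asymptotically, at GUIDANCE grade): MK(b=2)'s
decrement tends to `0.2507 β_W`/octave (ideator's Bessel-exact numerics; Migdal's `1/4`-type recursion), one-loop asymptotic
freedom moves the true coupling by `8b₀ln2 = 0.2575`/octave, so the lag grows `≈ 0.10` octave per unit `β_W` and no fixed `k₀`
survives `β → ∞` if `a(β)` tracks `ξ_true` (which `LowerBounds` forces); finite on any bounded window (`k₀ ≈ 11` at
`β_W ≤ 2.7`).  [Ito1985; MullerSchiemann1988; arXiv:0911.5012 §4; this line's card, table T1] -/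
def MKBoundedLag : Prop :=
  ∀ (G : Type) [Group G] [TopologicalSpace G] [IsTopologicalGroup G] [CompactSpace G],
    IsCompactSimpleLieGroup G → SimplyConnectedSpace G →
    letI : MeasurableSpace G := borel G
    haveI : BorelSpace G := ⟨rfl⟩
    ∀ (r : LatticeRep G) (a : ℝ → ℝ), (∀ β, 0 < a β) → Tendsto a atTop (𝓝 0) → LowerBounds G r a →
      ∃ (k₀ : ℕ) (βM : ℝ), ∀ β : ℝ, βM ≤ β → ∀ n : ℕ, (2 : ℝ) ^ k₀ ≤ a β * 2 ^ n →
        Continuous (mkIter n (wilsonPlaqWeight r.ρ β)) ∧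
          ∀ U : G, |mkIter n (wilsonPlaqWeight r.ρ β) U - 1| ≤ 1 / 1000

/-- **V (residual, E-adjacent) — vacuum-sector purity on the pinned corridor.**  Under the crux's hypotheses there is `S > 0` such
that for every pin `T`, beyond `β_V(T)`, EVERY cold `4:1` box with `S ≤ a(β)·L ≤ T` has, for some finite set `s ∋ 1` of central
temporal twists (intended: all of `Z(G)³`, projecting the thermal trace onto the zero-electric-flux sector), projected period-doubling
defect `≤ 1/96`.  This is the `0⁺⁺`-gap-and-unique-vacuum half of purity, which NO twist ∕ vortex observable sees and MK cannot
supply; `E ⇒ V` at each box (`s = {1}`).  FALSE for `U(1)₄` (photon gas in the flux-free sector).  Why it might fail for `SU(N)`: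
it is summit-adjacent (row 21's V, here on all corridor boxes rather than at one box of V's choosing, because the MK-certified box
`8·2ⁿ` is located only up to the corridor). ['t Hooft 1979; Lüscher 1982; row 21 `VacuumSectorPuritySC`] -/
def VacuumPurityCorridor : Prop :=
  ∀ (G : Type) [Group G] [TopologicalSpace G] [IsTopologicalGroup G] [CompactSpace G],
    IsCompactSimpleLieGroup G → SimplyConnectedSpace G →
    letI : MeasurableSpace G := borel G
    haveI : BorelSpace G := ⟨rfl⟩
    ∀ (r : LatticeRep G) (a : ℝ → ℝ), (∀ β, 0 < a β) → Tendsto a atTop (𝓝 0) → LowerBounds G r a →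
      ∃ S : ℝ, 0 < S ∧ ∀ T : ℝ, ∃ βV : ℝ, ∀ β : ℝ, βV ≤ β → ∀ L : ℕ, 8 ≤ L →
        S ≤ a β * (L : ℝ) → a β * (L : ℝ) ≤ T →
          ∃ s : Finset (Fin 4 → G), (1 : Fin 4 → G) ∈ s ∧ (∀ z ∈ s, ∀ μ, z μ ∈ Subgroup.center G) ∧
            1 - (s.card : ℝ) * (∑ z ∈ s, wilsonFinTorusTwistedPartition r.ρ β z L L L (2 * (L / 4))) /
                (∑ z ∈ s, wilsonFinTorusTwistedPartition r.ρ β z L L L (L / 4)) ^ 2 ≤ 1 / 96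

/-! ## §2 Row 21's seam, re-spelled over `wilsonFinTorusTwistedPartition` (PROVED; DEDUP: idea-10 `flux_purity_split.lean` §2) -/

/-- **The arithmetic of the cut** (verbatim row 21).  If `S₁, S₂` are within the fraction `ε` of `n Z₁, n Z₂` and the projected
defect `1 − n S₂/S₁²` is `≤ ε`, then `1 − Z₂/Z₁² ≤ 4ε` (`ε ≤ 1/8`). -/
theorem defect_le_of_flux_vac (Z₁ Z₂ S₁ S₂ n ε : ℝ) (hn : 1 ≤ n) (hZ₁ : 0 < Z₁) (hZ₂ : 0 < Z₂)
    (hε0 : 0 ≤ ε) (hε : ε ≤ 1 / 8)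
    (ha : |S₁ - n * Z₁| ≤ ε * (n * Z₁)) (hb : |S₂ - n * Z₂| ≤ ε * (n * Z₂))
    (hc : 1 - n * S₂ / S₁ ^ 2 ≤ ε) : 1 - Z₂ / Z₁ ^ 2 ≤ 4 * ε := by
  have hn0 : 0 < n := lt_of_lt_of_le one_pos hn
  have hnZ₁ : 0 < n * Z₁ := mul_pos hn0 hZ₁
  have hnZ₂ : 0 < n * Z₂ := mul_pos hn0 hZ₂
  have hS₁ : (1 - ε) * (n * Z₁) ≤ S₁ := by
    have := (abs_sub_le_iff.1 ha).2
    nlinarith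
  have h1ε : 0 < 1 - ε := by linarith
  have hS₁pos : 0 < S₁ := lt_of_lt_of_le (mul_pos h1ε hnZ₁) hS₁
  have hS₂ : S₂ ≤ (1 + ε) * (n * Z₂) := by
    have := (abs_sub_le_iff.1 hb).1
    nlinarith
  have hS₁sq : 0 < S₁ ^ 2 := by positivity
  have hc' : (1 - ε) * S₁ ^ 2 ≤ n * S₂ := by
    have h1 : 1 - ε ≤ n * S₂ / S₁ ^ 2 := by linarith
    exact (le_div_iff₀ hS₁sq).1 h1
  have h3 : (1 - ε) ^ 2 * (n * Z₁) ^ 2 ≤ S₁ ^ 2 := by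
    have h0 : 0 ≤ (1 - ε) * (n * Z₁) := le_of_lt (mul_pos h1ε hnZ₁)
    have := pow_le_pow_left₀ h0 hS₁ 2
    simpa [mul_pow] using this
  have h4 : (1 - ε) ^ 3 * (n * Z₁) ^ 2 ≤ n * S₂ := by
    have := mul_le_mul_of_nonneg_left h3 (le_of_lt h1ε)
    nlinarith
  have h5 : n * S₂ ≤ (1 + ε) * n * (n * Z₂) := by nlinarith
  have h6 : (1 - ε) ^ 3 * Z₁ ^ 2 ≤ (1 + ε) * Z₂ := by
    have h45 : (1 - ε) ^ 3 * (n * Z₁) ^ 2 ≤ (1 + ε) * n * (n * Z₂) := le_trans h4 h5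
    have hn2 : 0 < n ^ 2 := by positivity
    have : (1 - ε) ^ 3 * Z₁ ^ 2 * n ^ 2 ≤ (1 + ε) * Z₂ * n ^ 2 := by nlinarith
    exact le_of_mul_le_mul_right this hn2
  have h7 : (1 - 4 * ε) * (1 + ε) ≤ (1 - ε) ^ 3 := by
    have h : 0 ≤ ε ^ 2 * (7 - ε) := mul_nonneg (sq_nonneg ε) (by linarith)
    nlinarith [h]
  have hZ₁sq : 0 < Z₁ ^ 2 := by positivity
  have h8 : (1 - 4 * ε) * Z₁ ^ 2 ≤ Z₂ := by
    have h1e : 0 < 1 + ε := by linarith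
    have : (1 - 4 * ε) * (1 + ε) * Z₁ ^ 2 ≤ (1 + ε) * Z₂ := by nlinarith
    nlinarith
  have h9 : 1 - 4 * ε ≤ Z₂ / Z₁ ^ 2 := by
    rw [le_div_iff₀ hZ₁sq]
    exact h8
  linarith

section Seams

variable {G : Type} [Group G] [TopologicalSpace G] [IsTopologicalGroup G] [CompactSpace G]
  [MeasurableSpace G] [BorelSpace G]

/-- **`F ∧ V ⇒ E` at one `(G, r, β, L)`** over a twist set `s` (row 21's `coldDefect_le_of_flux_vac`, with the twisted partition
function spelled `wilsonFinTorusTwistedPartition r.ρ β z L L L t`). -/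
theorem coldDefect_le_of_flux_vac_tw (r : LatticeRep G) (β : ℝ) (L : ℕ) {ε : ℝ} (hε0 : 0 ≤ ε) (hε : ε ≤ 1 / 8)
    (s : Finset (Fin 4 → G)) (h1 : (1 : Fin 4 → G) ∈ s)
    (hF : ∀ z ∈ s, ∀ t : ℕ, (t = L / 4 ∨ t = 2 * (L / 4)) →
      |wilsonFinTorusTwistedPartition r.ρ β z L L L t - wilsonFinTorusPartition r.ρ β L L L t| ≤
        ε * wilsonFinTorusPartition r.ρ β L L L t)
    (hV : 1 - (s.card : ℝ) * (∑ z ∈ s, wilsonFinTorusTwistedPartition r.ρ β z L L L (2 * (L / 4))) /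
              (∑ z ∈ s, wilsonFinTorusTwistedPartition r.ρ β z L L L (L / 4)) ^ 2 ≤ ε) :
    coldDefect r.ρ β L ≤ 4 * ε := by
  haveI : SecondCountableTopology G :=
    (r.continuous.isClosedEmbedding r.injective).isEmbedding.secondCountableTopology
  set Z₁ := wilsonFinTorusPartition r.ρ β L L L (L / 4) with hZ₁def
  set Z₂ := wilsonFinTorusPartition r.ρ β L L L (2 * (L / 4)) with hZ₂def
  have hZ₁ : 0 < Z₁ := wilsonFinTorusPartition_pos r.continuous β L L L (L / 4)
  have hZ₂ : 0 < Z₂ := wilsonFinTorusPartition_pos r.continuous β L L L (2 * (L / 4))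
  have hn : (1 : ℝ) ≤ (s.card : ℝ) := by
    exact_mod_cast Finset.card_pos.2 ⟨1, h1⟩
  have hsum : ∀ t : ℕ, (t = L / 4 ∨ t = 2 * (L / 4)) →
      |∑ z ∈ s, wilsonFinTorusTwistedPartition r.ρ β z L L L t - (s.card : ℝ) * wilsonFinTorusPartition r.ρ β L L L t| ≤
        ε * ((s.card : ℝ) * wilsonFinTorusPartition r.ρ β L L L t) := by
    intro t ht
    have hrw : ∑ z ∈ s, wilsonFinTorusTwistedPartition r.ρ β z L L L t -
        (s.card : ℝ) * wilsonFinTorusPartition r.ρ β L L L t =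
        ∑ z ∈ s, (wilsonFinTorusTwistedPartition r.ρ β z L L L t - wilsonFinTorusPartition r.ρ β L L L t) := by
      rw [Finset.sum_sub_distrib, Finset.sum_const, nsmul_eq_mul]
    rw [hrw]
    calc |∑ z ∈ s, (wilsonFinTorusTwistedPartition r.ρ β z L L L t - wilsonFinTorusPartition r.ρ β L L L t)|
        ≤ ∑ z ∈ s, |wilsonFinTorusTwistedPartition r.ρ β z L L L t - wilsonFinTorusPartition r.ρ β L L L t| :=
          Finset.abs_sum_le_sum_abs _ _
      _ ≤ ∑ z ∈ s, ε * wilsonFinTorusPartition r.ρ β L L L t := Finset.sum_le_sum fun z hz => hF z hz t ht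
      _ = ε * ((s.card : ℝ) * wilsonFinTorusPartition r.ρ β L L L t) := by
          rw [Finset.sum_const, nsmul_eq_mul]; ring
  have ha := hsum (L / 4) (Or.inl rfl)
  have hb := hsum (2 * (L / 4)) (Or.inr rfl)
  show 1 - Z₂ / Z₁ ^ 2 ≤ 4 * ε
  exact defect_le_of_flux_vac Z₁ Z₂ _ _ (s.card : ℝ) ε hn hZ₁ hZ₂ hε0 hε ha hb hV

/-- **Twist cost `≤ ε` plus reflection positivity give the two-sided flux bound F at one box** (`t ≥ 2`, `β ≥ 0`, central `z`):
`|Z⁽ᶻ⁾ − Z| ≤ ε·Z`.  Upper side: the landed `TwistCost.twistedPartition_le` (`Z⁽ᶻ⁾ ≤ Z`). -/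
theorem abs_twisted_sub_le_of_twistCost (r : LatticeRep G) {β : ℝ} (hβ : 0 ≤ β) (L m : ℕ) {z : Fin 4 → G}
    (hz : ∀ μ, z μ ∈ Subgroup.center G) {ε : ℝ}
    (hc : twistCost r.ρ β z L (m + 2) ≤ ε) :
    |wilsonFinTorusTwistedPartition r.ρ β z L L L (m + 2) - wilsonFinTorusPartition r.ρ β L L L (m + 2)| ≤
      ε * wilsonFinTorusPartition r.ρ β L L L (m + 2) := by
  haveI : SecondCountableTopology G :=
    (r.continuous.isClosedEmbedding r.injective).isEmbedding.secondCountableTopology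
  have hZ : 0 < wilsonFinTorusPartition r.ρ β L L L (m + 2) := wilsonFinTorusPartition_pos r.continuous β L L L (m + 2)
  have hup : wilsonFinTorusTwistedPartition r.ρ β z L L L (m + 2) ≤ wilsonFinTorusPartition r.ρ β L L L (m + 2) :=
    twistedPartition_le r.continuous r.mem_unitary hβ L L L m hz
  have hlow : (1 - ε) * wilsonFinTorusPartition r.ρ β L L L (m + 2) ≤
      wilsonFinTorusTwistedPartition r.ρ β z L L L (m + 2) := by
    unfold twistCost at hc
    have h1 : 1 - ε ≤ wilsonFinTorusTwistedPartition r.ρ β z L L L (m + 2) /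
        wilsonFinTorusPartition r.ρ β L L L (m + 2) := by linarith
    exact (le_div_iff₀ hZ).1 h1
  rw [abs_sub_le_iff]
  constructor
  · nlinarith
  · nlinarith

end Seams

/-! ## §3 The stubs (ALL the content) -/

/-- S_sc — support (strong-coupling polymer expansion; theorem-grade, M). -/
theorem stub_scTwistBound : SCTwistBound := by
  sorry

/-- K_min — crux, rank 3 (Tomboulis's MK twist minorant at `r = 1`, cold-box form; L). -/
theorem stub_mkTwistMinorant : MKTwistMinorant := by
  sorry

/-- K_lag — crux, rank 2, THE MEASURED DEFICIT (bounded MK lag behind the floor scale; XL; guidance-false as `β → ∞`, see card). -/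
theorem stub_mkBoundedLag : MKBoundedLag := by
  sorry

/-- V — residual (vacuum-sector purity on the pinned corridor; E-adjacent, XL). -/
theorem stub_vacuumPurityCorridor : VacuumPurityCorridor := by
  sorry

/-! ## §4 The composition (PROVED): K_lag ∧ K_min ∧ S_sc ∧ V ⇒ PX(1∕24) ⇒ PXcof(1∕24) ⇒ (with N_cof) IRcof -/

/-- A real number is dominated by `a · 2ⁿ` for some `n` (`a > 0`). -/
theorem exists_le_mul_two_pow {M c : ℝ} (hc : 0 < c) : ∃ n : ℕ, M ≤ c * 2 ^ n := by
  obtain ⟨m, hm⟩ := exists_nat_gt (M / c)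
  refine ⟨m, ?_⟩
  have h2 : (m : ℝ) ≤ (2 : ℝ) ^ m := by
    have h := Nat.lt_two_pow_self (n := m)
    exact_mod_cast h.le
  have h3 : M / c ≤ 2 ^ m := le_trans hm.le h2
  rw [div_le_iff₀ hc] at h3
  linarith [h3]

/-- **THE BILL OF THIS LINE, 19354 currency**: K_lag ∧ K_min ∧ S_sc ∧ V ⇒ `PinnedExit96.PinnedExitAt (1/24)` (token PX, literally). -/
theorem pinnedExitAt_of (hS : SCTwistBound) (hM : MKTwistMinorant) (hL : MKBoundedLag) (hV : VacuumPurityCorridor) :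
    PinnedExitAt (1 / 24) := by
  intro G _ _ _ _ hG hsc
  letI : MeasurableSpace G := borel G
  haveI : BorelSpace G := ⟨rfl⟩
  intro r a ha ha0 hlb
  obtain ⟨k₀, βM, hlag⟩ := hL G hG hsc r a ha ha0 hlb
  obtain ⟨SK, βK, hmin⟩ := hM G hG hsc r a ha ha0 hlb
  obtain ⟨S, hS0, hVT⟩ := hV G hG hsc r a ha ha0 hlb
  set M₀ : ℝ := max (max ((2 : ℝ) ^ k₀) (S / 8)) (SK / 8) with hM₀def
  have h2k : (0 : ℝ) < (2 : ℝ) ^ k₀ := by positivity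
  have hM₀ : 0 < M₀ := lt_of_lt_of_le h2k (le_trans (le_max_left _ _) (le_max_left _ _))
  obtain ⟨βV, hVβ⟩ := hVT (16 * M₀)
  obtain ⟨βa, hβa⟩ := eventually_atTop.1 (ha0.eventually (gt_mem_nhds hM₀))
  refine ⟨16 * M₀, max (max (max βM βV) (max βa 0)) βK, fun β hβ => ?_⟩
  have hβ' : max (max βM βV) (max βa 0) ≤ β := le_trans (le_max_left _ _) hβ
  have hβK : βK ≤ β := le_trans (le_max_right _ _) hβ
  have hβM : βM ≤ β := le_trans (le_trans (le_max_left _ _) (le_max_left _ _)) hβ'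
  have hβV : βV ≤ β := le_trans (le_trans (le_max_right _ _) (le_max_left _ _)) hβ'
  have hβa' : βa ≤ β := le_trans (le_trans (le_max_left _ _) (le_max_right _ _)) hβ'
  have hβ0 : 0 ≤ β := le_trans (le_trans (le_max_right _ _) (le_max_right _ _)) hβ'
  have haM : a β < M₀ := hβa β hβa'
  -- the MK level: the least `n` with `M₀ ≤ a β · 2ⁿ`
  classical
  have hex : ∃ n : ℕ, M₀ ≤ a β * 2 ^ n := exists_le_mul_two_pow (ha β)
  obtain ⟨n, hn, hnmin⟩ : ∃ n : ℕ, M₀ ≤ a β * 2 ^ n ∧ ∀ m : ℕ, m < n → ¬ M₀ ≤ a β * 2 ^ m :=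
    ⟨Nat.find hex, Nat.find_spec hex, fun m hm => Nat.find_min hex hm⟩
  have hup : a β * 2 ^ n ≤ 2 * M₀ := by
    rcases Nat.eq_zero_or_pos n with h0 | hpos
    · subst h0
      simp only [pow_zero, mul_one]
      linarith
    · have hlt := hnmin (n - 1) (by omega)
      push Not at hlt
      have h2n : (2 : ℝ) ^ n = 2 * 2 ^ (n - 1) := by
        rw [← pow_succ']
        congr 1
        omega
      rw [h2n]
      nlinarith [ha β]
  have hk₀ : (2 : ℝ) ^ k₀ ≤ a β * 2 ^ n := le_trans (le_trans (le_max_left _ _) (le_max_left _ _)) hn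
  have hS8 : S / 8 ≤ a β * 2 ^ n := le_trans (le_trans (le_max_right _ _) (le_max_left _ _)) hn
  have hSK8 : SK / 8 ≤ a β * 2 ^ n := le_trans (le_max_right _ _) hn
  have hSK : SK ≤ a β * (8 * (2 : ℝ) ^ n) := by nlinarith [ha β]
  -- the box
  refine ⟨8 * 2 ^ n, ?_, ?_, ?_⟩
  · have h1 : 1 ≤ 2 ^ n := Nat.one_le_two_pow
    omega
  · have hcast : ((8 * 2 ^ n : ℕ) : ℝ) = 8 * (2 : ℝ) ^ n := by push_cast; ring
    rw [hcast]
    nlinarith [ha β]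
  · -- purity from F (= K_min + S_sc + K_lag + RP) and V via the seam at ε = 1/96
    have hL4 : 8 * 2 ^ n / 4 = 2 * 2 ^ n := by omega
    have hcast : ((8 * 2 ^ n : ℕ) : ℝ) = 8 * (2 : ℝ) ^ n := by push_cast; ring
    have hSL : S ≤ a β * ((8 * 2 ^ n : ℕ) : ℝ) := by rw [hcast]; nlinarith [ha β]
    have hLT : a β * ((8 * 2 ^ n : ℕ) : ℝ) ≤ 16 * M₀ := by rw [hcast]; nlinarith [ha β]
    have hL8 : 8 ≤ 8 * 2 ^ n := by have h1 : 1 ≤ 2 ^ n := Nat.one_le_two_pow; omega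
    obtain ⟨s, h1s, hcen, hVs⟩ := hVβ β hβV (8 * 2 ^ n) hL8 hSL hLT
    have hmk := hlag β hβM n hk₀
    have hpure := coldDefect_le_of_flux_vac_tw r β (8 * 2 ^ n) (ε := 1 / 96) (by norm_num) (by norm_num) s h1s ?_ hVs
    · linarith
    · intro z hz t ht
      have hzc := hcen z hz
      rw [hL4] at ht
      -- `t = t₀ · 2ⁿ` with `t₀ ∈ {2, 4}`; write `t = m + 2`
      obtain ⟨t₀, ht₀, rfl⟩ : ∃ t₀ : ℕ, (t₀ = 2 ∨ t₀ = 4) ∧ t = t₀ * 2 ^ n := by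
        rcases ht with h | h
        · exact ⟨2, Or.inl rfl, by rw [h]⟩
        · exact ⟨4, Or.inr rfl, by rw [h]; ring⟩
      have hmin' := hmin β hβK n hSK z hzc t₀ ht₀
      have hsc' := hS G (mkIter n (wilsonPlaqWeight r.ρ β)) hmk.1 hmk.2 z hzc t₀ ht₀
      have hcost : twistCost r.ρ β z (8 * 2 ^ n) (t₀ * 2 ^ n) ≤ 1 / 96 := le_trans hmin' hsc'
      obtain ⟨m, hm⟩ : ∃ m : ℕ, t₀ * 2 ^ n = m + 2 := by
        have h1 : 1 ≤ 2 ^ n := Nat.one_le_two_pow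
        have h2 : 2 ≤ t₀ := by rcases ht₀ with h | h <;> omega
        have h3 : 2 ≤ t₀ * 2 ^ n := by
          have := Nat.mul_le_mul h2 h1
          simpa using this
        exact ⟨t₀ * 2 ^ n - 2, (Nat.sub_add_cancel h3).symm⟩
      rw [hm] at hcost ⊢
      exact abs_twisted_sub_le_of_twistCost r hβ0 (8 * 2 ^ n) m hzc hcost

/-- **26930 currency**: the same four obligations give the slot token `PinnedCofinalBill.PinnedExitsCofinalAt (1/24)` (PXcof,
literally), through the landed `PinnedExitCofinal.pinnedExitsCofinal_of_pinnedExitAt` (PX ⇒ PXcof). -/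
theorem pxcof24_of (hS : SCTwistBound) (hM : MKTwistMinorant) (hL : MKBoundedLag)
    (hV : VacuumPurityCorridor) : PXcof24 :=
  pinnedExitsCofinal_of_pinnedExitAt (pinnedExitAt_of hS hM hL hV)

/-- **With the slot's residual N_cof, the crux BY NAME**: K_lag ∧ K_min ∧ S_sc ∧ V ∧ `IRnscCof` ⇒ `Theses.BalabanLadder.IRcof`
(the slot's 8-line composition `PinnedCofinalBill.IRcof_of` over the landed X-free cofinal kernel, repeated verbatim). -/
theorem IRcof_of (hS : SCTwistBound) (hM : MKTwistMinorant) (hL : MKBoundedLag) (hV : VacuumPurityCorridor)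
    (hN : IRnscCof) : Summit.QuantumFields.YangMills.Theses.BalabanLadder.IRcof := by
  have hP := pxcof24_of hS hM hL hV
  intro G _ _ _ _ hG
  letI : MeasurableSpace G := borel G
  haveI : BorelSpace G := ⟨rfl⟩
  intro r a ha ha0 hlb
  by_cases hsc : SimplyConnectedSpace G
  · obtain ⟨T, hcof⟩ := hP G hG hsc r a ha ha0 hlb
    exact cofinalGapOn_of_pinnedExits r a ha ha0 hcof
  · exact hN G hG hsc r a ha ha0 hlb

/-- The crux-headed compositions over the registered stubs of THIS line: token PX (19354) and token PXcof (26930); N_cof stays the slot's. -/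
theorem pinnedExitAt_of_stubs : PinnedExitAt (1 / 24) :=
  pinnedExitAt_of stub_scTwistBound stub_mkTwistMinorant stub_mkBoundedLag stub_vacuumPurityCorridor

theorem pxcof24_of_stubs : PXcof24 :=
  pxcof24_of stub_scTwistBound stub_mkTwistMinorant stub_mkBoundedLag stub_vacuumPurityCorridor

/-! ## §5 DEDUP anchors (by-name checks that the cited tree declarations exist) -/

example := @Tomboulis2007.MKTIneq
example := @Tomboulis2007.mkStepFun
example := @Tomboulis2007.MKFlowToStrongCoupling
example := @Literature.Barriers.QuantumFields.MigdalKadanoffGroupBlindness.not_mkConfinementCriterionU1D4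
example := @Literature.Barriers.QuantumFields.MigdalKadanoff.mkIter
example := @Summit.QuantumFields.YangMills.Cruxes.IR.TwistCost.half_twist_cost_le_coldDefect

end Summit.QuantumFields.YangMills.Cruxes.IRcof.MKLagSandwich

end
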